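import Summits.Langlands.Langlands.Theorems.ParityBlindBianchiTwoAdicBianchiProModularityLevelOddIndexLevelChange
import Mathlib.Data.Nat.Factorization.Basic
import HarnessLib

/-!
# `TwoAdicBianchiProModularityLevel` (crux stmt-Langlands-15110, route `ParityBlindBianchi`) —
# FINITE-INDEX LEVEL CHANGE: points of `Spf 𝕋` persist to every sub-tower of bounded index

Generic vocabulary of `CompletedCohomology` (`Γ → 𝒢`, towers `T' ≤ T`, Hecke elements `δ : J → 𝒢`,
coefficients `k`, `ϖ`).  `…OddIndexLevelChange` (lead c9) proved that points of `Spf 𝕋(T)` are points of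
`Spf 𝕋(T')` when the indices `[K(s) : K'(s)]` are UNITS of `k`.  Here the unit hypothesis is removed:
it suffices that the indices divide one natural number `N` which `k` ABSORBS `ϖ`-adically
(`N · x ∈ (ϖ^{t+e}) ⇒ x ∈ (ϖ^t)` for a fixed `e`), which is the case for every `N ≠ 0` in `k = ℤ̄₂`
(`N = 2^e · odd`, odd numbers are units, `ℤ̄₂` is a domain).  Mechanism: if `P` kills finitely many
pieces of `T'` then `N · P` kills the corresponding pieces of `T` (restriction–transfer), so
`N · P(χ) ∈ (ϖ^{t+e})` by the stage `t + e` of the point `χ`, whence `P(χ) ∈ (ϖ^t)` — the index torsion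
is paid for by reading the point one notch deeper, which a point of `Spf 𝕋` (all `t` at once) affords.

* `IsHeckePoint.of_subtower_of_dvd`, `IsHeckePoint.of_subtower_of_dvd_of_bijOn` — the generic statements;
* `absorb_of_eq_unit_mul_pow` — `N = u ϖ^e`, `u` a unit, `ϖ` a non-zero-divisor ⇒ `k` absorbs `N`;
* `exists_absorb_natCast_valuationSubring_two` — `ℤ̄₂` absorbs every `N ≠ 0` (with `ϖ = 2`);
* `crux_isHeckePoint_of_subtower_finiteIndex` — the crux's literal setting (`Γ = GL₂(K) → GL₂(𝔸_K^∞)`,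
  Hecke family `(v,i) ↦ (t_{v,i+1})_f`, `k = ℤ̄₂`, `ϖ = 2`): for towers `T' ≤ T` with corresponding,
  finite good double cosets and indices `0 < [K(s):K'(s)] ≤ D`, Hecke data that are a point of `Spf 𝕋(T)`
  are a point of `Spf 𝕋(T')` — ALL finite indices, not only odd ones.  Bearing on stub B
  (`stub_artinLift`, conclusion `∃ U …`): the tame level of B's conclusion can be shrunk to ANY open
  `U' ≤ U` hyperspecial at the good places (the adelic plumbing is `…TameLevelMonotone`), including
  even-index steps at the odd places of `S₀` and arbitrary shrinking at the places over `2`.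

Sorry-free, definition-free; lead c11 (line `Sketch`, cycle 12).
-/

noncomputable section

set_option linter.dupNamespace false

namespace Summit.Langlands.Langlands.Theorems.TwoAdicBianchiProModularityLevel

open CategoryTheory Literature.NumberTheory.Automorphic

universe v

/-! ### Generic: points persist to sub-towers whose indices divide an absorbed `N` -/

section Generic

variable {k : Type} [CommRing k] {Γ 𝒢 : Type} [Group Γ] [Group 𝒢]
  {ι : Γ →* 𝒢} {T T' : LevelTower 𝒢} {ϖ : k} {J : Type v} {δ : J → 𝒢} {χ : J → k}

/-- **Points persist to sub-towers of absorbed index.**  Let `T'` be a sub-tower of `T`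
(`K'(s) ≤ K(s)`) whose Hecke operators `T_{δ j}` commute with the pull-backs, and suppose every index
`[K(s) : K'(s)]` divides a natural number `N` which `k` absorbs `ϖ`-adically with delay `e`
(`N x ∈ (ϖ^{t+e}) ⇒ x ∈ (ϖ^t)`).  Then every point `χ` of `Spf 𝕋(T)` is a point of `Spf 𝕋(T')`:
if `P` kills the pieces `z ∈ I_{t+e}` of `T'` then `N · P` kills the corresponding pieces of `T`
(`res ∘ P_T = P_{T'} ∘ res = 0` and `[K(s):K'(s)] · ker res = 0`,
`relIndex_smul_eq_zero_of_cohomologyPullback_eq_zero`), so `N · P(χ) ∈ (ϖ^{t+e})` and `P(χ) ∈ (ϖ^t)`.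
[cite: Brown1982CohomologyGroups, Ch. III, Prop. 9.5 (ii), Prop. 10.1] -/
theorem IsHeckePoint.of_subtower_of_dvd (hle : ∀ s, T'.level s ≤ T.level s)
    (hcomm : ∀ (j : J) (z : TowerIndex),
      (ArithmeticQuotient.cohomologyPullback k ι (modPow k ϖ z.2.2) (hle z.2.1) z.1).hom ∘ₗ
          towerHeckeFamily k ι T ϖ (δ j) z =
        towerHeckeFamily k ι T' ϖ (δ j) z ∘ₗ
          (ArithmeticQuotient.cohomologyPullback k ι (modPow k ϖ z.2.2) (hle z.2.1) z.1).hom)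
    {N e : ℕ} (hN : ∀ s, (T'.level s).relIndex (T.level s) ∣ N)
    (habs : ∀ (t : ℕ) (x : k), ((N : ℕ) : k) * x ∈ Ideal.span {ϖ ^ (t + e)} → x ∈ Ideal.span {ϖ ^ t})
    (h : IsHeckePoint ι T ϖ δ χ) : IsHeckePoint ι T' ϖ δ χ := by
  classical
  rw [isHeckePoint_iff_forall_freeAlgebra] at h ⊢
  intro t
  obtain ⟨I, hI⟩ := h (t + e)
  refine ⟨I, fun P hP => habs t _ ?_⟩
  -- `(N • P)_T` kills the pieces of `I`
  have hkill : ∀ z ∈ I,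
      FreeAlgebra.lift k (fun j => towerHeckeFamily k ι T ϖ (δ j)) (((N : ℕ) : k) • P) z = 0 := by
    intro z hz
    rw [map_smul, Pi.smul_apply, lift_towerHeckeFamily_apply]
    refine LinearMap.ext fun x => ?_
    rw [LinearMap.smul_apply, LinearMap.zero_apply]
    -- `res (P_T x) = P_{T'} (res x) = 0`
    have hres : (ArithmeticQuotient.cohomologyPullback k ι (modPow k ϖ z.2.2) (hle z.2.1) z.1).hom
        (FreeAlgebra.lift k (fun j => towerHeckeFamily k ι T ϖ (δ j) z) P x) = 0 := by
      have hc := LinearMap.congr_fun (comp_lift_eq_lift_comp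
        (fun j => towerHeckeFamily k ι T ϖ (δ j) z) (fun j => towerHeckeFamily k ι T' ϖ (δ j) z)
        (ArithmeticQuotient.cohomologyPullback k ι (modPow k ϖ z.2.2) (hle z.2.1) z.1).hom
        (fun j => hcomm j z) P) x
      have hP' : FreeAlgebra.lift k (fun j => towerHeckeFamily k ι T' ϖ (δ j) z) P = 0 := by
        rw [← lift_towerHeckeFamily_apply ι ϖ δ T', hP z hz]
      rw [LinearMap.comp_apply, LinearMap.comp_apply, hP', LinearMap.zero_apply] at hc
      exact hc
    have h1 := ArithmeticQuotient.relIndex_smul_eq_zero_of_cohomologyPullback_eq_zero k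
      (T.level z.2.1) (T'.level z.2.1) (modPow k ϖ z.2.2) ι (hle z.2.1) z.1 hres
    obtain ⟨m, hm⟩ := hN z.2.1
    rw [Nat.cast_smul_eq_nsmul, hm, mul_nsmul, h1, smul_zero]
  have hval := hI _ hkill
  rwa [map_smul, smul_eq_mul] at hval

/-- **Points persist to sub-towers of absorbed index** — double-coset form of the commutation
hypothesis (`K'(s) δ_j K'(s) / K'(s) → K(s) δ_j K(s) / K(s)` bijective onto a finite set).
[cite: Brown1982CohomologyGroups, Ch. III, Prop. 9.5 (ii), Prop. 10.1] -/
theorem IsHeckePoint.of_subtower_of_dvd_of_bijOn (hle : ∀ s, T'.level s ≤ T.level s)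
    (hbij : ∀ (s : ℕ) (j : J), Set.BijOn (Subgroup.quotientMapOfLE (hle s))
      (ArithmeticQuotient.doubleCosetQuot (T'.level s) (δ j))
      (ArithmeticQuotient.doubleCosetQuot (T.level s) (δ j)))
    (hfin : ∀ (s : ℕ) (j : J), (ArithmeticQuotient.doubleCosetQuot (T.level s) (δ j)).Finite)
    {N e : ℕ} (hN : ∀ s, (T'.level s).relIndex (T.level s) ∣ N)
    (habs : ∀ (t : ℕ) (x : k), ((N : ℕ) : k) * x ∈ Ideal.span {ϖ ^ (t + e)} → x ∈ Ideal.span {ϖ ^ t})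
    (h : IsHeckePoint ι T ϖ δ χ) : IsHeckePoint ι T' ϖ δ χ := by
  refine IsHeckePoint.of_subtower_of_dvd hle (fun j z => ?_) hN habs h
  have hc := ArithmeticQuotient.heckeOperator_comp_cohomologyPullback k ι (modPow k ϖ z.2.2)
    (hle z.2.1) (δ j) (hbij z.2.1 j) (hfin z.2.1 j) z.1
  have hc' := congrArg ModuleCat.Hom.hom hc
  rw [ModuleCat.hom_comp, ModuleCat.hom_comp] at hc'
  exact hc'

/-- **Absorption from a unit–power factorisation.**  In a commutative ring, if `N = u · ϖ^e` with
`u` a unit and `ϖ` a non-zero-divisor, then `N x ∈ (ϖ^{t+e})` implies `x ∈ (ϖ^t)`. [folklore] -/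
theorem absorb_of_eq_unit_mul_pow {N u : k} {e : ℕ} (hu : IsUnit u) (hϖ : ϖ ∈ nonZeroDivisors k)
    (hN : N = u * ϖ ^ e) (t : ℕ) (x : k) (hx : N * x ∈ Ideal.span {ϖ ^ (t + e)}) :
    x ∈ Ideal.span {ϖ ^ t} := by
  rw [Ideal.mem_span_singleton] at hx ⊢
  obtain ⟨c, hc⟩ := hx
  obtain ⟨w, rfl⟩ := hu
  subst hN
  have heq : ϖ ^ e * ((w : k) * x) = ϖ ^ e * (ϖ ^ t * c) := by
    calc ϖ ^ e * ((w : k) * x) = (w : k) * ϖ ^ e * x := by ring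
      _ = ϖ ^ (t + e) * c := hc
      _ = ϖ ^ e * (ϖ ^ t * c) := by ring
  have hcancel : (w : k) * x = ϖ ^ t * c :=
    (mul_cancel_left_mem_nonZeroDivisors (pow_mem hϖ e)).mp heq
  refine ⟨(↑w⁻¹ : k) * c, ?_⟩
  calc x = (↑w⁻¹ : k) * ((w : k) * x) := by rw [← mul_assoc, Units.inv_mul, one_mul]
    _ = (↑w⁻¹ : k) * (ϖ ^ t * c) := by rw [hcancel]
    _ = ϖ ^ t * ((↑w⁻¹ : k) * c) := by ring

end Generic

/-! ### `ℤ̄₂` absorbs every non-zero natural number -/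

section Absorb

/-- **`ℤ̄₂` absorbs every `N ≠ 0` `2`-adically**: writing `N = 2^e · m` with `m` odd (a unit of `ℤ̄₂`,
`isUnit_natCast_valuationSubring_two_of_odd`), `N x ∈ (2^{t+e})` implies `x ∈ (2^t)` in the valuation
ring `ℤ̄₂` of `ℚ̄₂` (a domain of characteristic `0`). [folklore] -/
theorem exists_absorb_natCast_valuationSubring_two {N : ℕ} (hN : N ≠ 0) :
    ∃ e : ℕ, ∀ (t : ℕ) (x : (PadicAlgCl.valued 2).v.valuationSubring),
      ((N : ℕ) : (PadicAlgCl.valued 2).v.valuationSubring) * x ∈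
          Ideal.span {((2 : ℕ) : (PadicAlgCl.valued 2).v.valuationSubring) ^ (t + e)} →
        x ∈ Ideal.span {((2 : ℕ) : (PadicAlgCl.valued 2).v.valuationSubring) ^ t} := by
  obtain ⟨e, m, hm, rfl⟩ := Nat.exists_eq_two_pow_mul_odd hN
  refine ⟨e, fun t x hx =>
    absorb_of_eq_unit_mul_pow (isUnit_natCast_valuationSubring_two_of_odd hm) ?_ ?_ t x hx⟩
  · refine mem_nonZeroDivisors_of_ne_zero fun h => ?_
    have h' := congrArg (fun y : (PadicAlgCl.valued 2).v.valuationSubring => (y : PadicAlgCl 2)) h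
    simp at h'
  · push_cast
    ring

end Absorb


/-! ### The crux's setting: `k = ℤ̄₂`, all finite indices -/

section Crux

open scoped NumberField
open IsDedekindDomain

/-- **Finite-index level change, in the crux's vocabulary** (registered sub-goal).  For
`Γ = GL₂(K) → 𝒢 = GL₂(𝔸_K^∞)` diagonally, two towers `T' ≤ T` of `𝒢` (for the crux and stub B:
`T = (U ∩ K((2)^s))_s`, `T' = (U' ∩ K((2)^s))_s` with `U' ≤ U`), the Hecke family
`(v, i) ↦ (t_{v,i+1})_f` over a type `S` of (good) places whose double cosets at the levels of `T'` and
`T` correspond bijectively and are finite, coefficients `ℤ̄₂`, `ϖ = 2`: if the indices `[K(s) : K'(s)]`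
are finite and BOUNDED (`0 < [K(s):K'(s)] ≤ D`; for `U' ≤ U` open in `U` compact they are all
`≤ [U : U']`), then Hecke data `a` forming a point of `Spf 𝕋` of `T` form a point of `Spf 𝕋` of `T'`
(every index divides `D!`, which `ℤ̄₂` absorbs).  Removes the oddness hypothesis of
`crux_isHeckePoint_of_subtower` (lead c9): in the conclusion of B / of the crux the tame level may be
shrunk along ANY finite-index step at no cost. [cite: Brown1982CohomologyGroups, Ch. III, Prop. 9.5 (ii),
Prop. 10.1] -/
theorem crux_isHeckePoint_of_subtower_finiteIndex : ∀ (K : Type) [Field K] [NumberField K]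
    (T T' : LevelTower (GL (Fin 2) (FiniteAdeleRing (𝓞 K) K))) (hle : ∀ s : ℕ, T'.level s ≤ T.level s)
    (S : Type) (pl : S → HeightOneSpectrum (𝓞 K))
    (ϖ : ∀ v : HeightOneSpectrum (𝓞 K), (v.adicCompletion K)ˣ)
    (a : S → ℕ → (PadicAlgCl.valued 2).v.valuationSubring) (D : ℕ),
    (∀ (s : ℕ) (j : S × Fin 2), Set.BijOn (Subgroup.quotientMapOfLE (hle s))
      (ArithmeticQuotient.doubleCosetQuot (T'.level s)
        (GLn.sndHom 2 K (heckeDiagAt 2 K (pl j.1) (ϖ (pl j.1)) (j.2.val + 1))))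
      (ArithmeticQuotient.doubleCosetQuot (T.level s)
        (GLn.sndHom 2 K (heckeDiagAt 2 K (pl j.1) (ϖ (pl j.1)) (j.2.val + 1))))) →
    (∀ (s : ℕ) (j : S × Fin 2), (ArithmeticQuotient.doubleCosetQuot (T.level s)
      (GLn.sndHom 2 K (heckeDiagAt 2 K (pl j.1) (ϖ (pl j.1)) (j.2.val + 1)))).Finite) →
    (∀ s : ℕ, (T'.level s).relIndex (T.level s) ≠ 0 ∧ (T'.level s).relIndex (T.level s) ≤ D) →
    IsHeckePoint
      (Matrix.GeneralLinearGroup.map (algebraMap K (FiniteAdeleRing (𝓞 K) K)) :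
        GL (Fin 2) K →* GL (Fin 2) (FiniteAdeleRing (𝓞 K) K))
      T ((2 : ℕ) : (PadicAlgCl.valued 2).v.valuationSubring)
      (fun j : S × Fin 2 => GLn.sndHom 2 K (heckeDiagAt 2 K (pl j.1) (ϖ (pl j.1)) (j.2.val + 1)))
      (fun j => a j.1 (j.2.val + 1)) →
    IsHeckePoint
      (Matrix.GeneralLinearGroup.map (algebraMap K (FiniteAdeleRing (𝓞 K) K)) :
        GL (Fin 2) K →* GL (Fin 2) (FiniteAdeleRing (𝓞 K) K))
      T' ((2 : ℕ) : (PadicAlgCl.valued 2).v.valuationSubring)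
      (fun j : S × Fin 2 => GLn.sndHom 2 K (heckeDiagAt 2 K (pl j.1) (ϖ (pl j.1)) (j.2.val + 1)))
      (fun j => a j.1 (j.2.val + 1)) := by
  intro K _ _ T T' hle S pl ϖ a D hbij hfin hidx hpt
  obtain ⟨e, he⟩ := exists_absorb_natCast_valuationSubring_two (Nat.factorial_ne_zero D)
  exact IsHeckePoint.of_subtower_of_dvd_of_bijOn hle hbij hfin
    (fun s => Nat.dvd_factorial (Nat.pos_of_ne_zero (hidx s).1) (hidx s).2) he hpt

end Crux

end Summit.Langlands.Langlands.Theorems.TwoAdicBianchiProModularityLevel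

end
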